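import Mathlib.Data.Nat.ModEq
import Mathlib.Data.List.Basic
import Mathlib.Data.List.InsertIdx
import Mathlib.Algebra.BigOperators.Fin
import Mathlib.Tactic.Ring
import HarnessLib

/-!
# The Varshamov–Tenengolts codes correct a single deletion (Levenshtein 1965)

A binary code `C ⊆ 𝔽₂ⁿ` *corrects one deletion* if the sets `D₁(u)` of words obtained from the
codewords `u` by deleting one letter are pairwise disjoint (N. J. A. Sloane, *On
single-deletion-correcting codes*, in: Codes and Designs (Columbus, OH, 2000), de Gruyter 2002,
273–291 = arXiv:math/0207197, Definition 1.1). The *Varshamov–Tenengolts code*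
`VT_a(n) = {x ∈ 𝔽₂ⁿ : ∑_{i=1}^{n} i·x_i ≡ a (mod n+1)}` (Sloane 2002, Definition 2.1;
Varshamov–Tenengolts 1965) was observed by Levenshtein (1965/66) to correct one deletion, "proving
this by giving the following elegant decoding algorithm" (Sloane 2002, §2): if the letter `s` in
position `p` is deleted, with `L₀, L₁` zeros/ones to its left and `R₀, R₁` to its right, and
`w = L₁ + R₁` is the weight of the received word, then the checksum drops by `R₁ ≤ w` if `s = 0`
and by `p + R₁ = 1 + w + L₀ > w` if `s = 1` — "these numbers are less than `n + 1` so there is no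
ambiguity" — so the deficiency of the checksum modulo `n + 1` tells which letter was deleted and
where to restore it (a `0` just to the left of the rightmost `R₁` ones, a `1` just to the right
of the leftmost `L₀` zeros).

## Contents

* `deletionBall u` (`D₁(u)`), `IsSingleDeletionCorrecting C` (Sloane 2002, Def. 1.1, `e = 1`).
* `VT.checksum x = ∑ i·x_i` (positions from `1`; recursive definition, identified with the
  printed sum in `VT.checksum_eq_sum`), `VT.code a n = VT_a(n)` (Sloane 2002, Def. 2.1).
* The checksum arithmetic of one insertion: `VT.checksum_insertIdx` (inserting the letter `b`
  at position `p` raises the checksum by `VT.shift z p b = b·(p+1) + R₁`), `VT.shift_le`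
  (the shift is at most `n`), and the key uniqueness statement
  `VT.insertIdx_eq_insertIdx_of_shift_eq`: two insertions into the same word with the same shift
  give the same word (this is the content of "no ambiguity": equal shifts force the same letter,
  inserted into the same run).
* **Levenshtein's theorem**: `VT.eq_of_eraseIdx_eq` / `VT.code_isSingleDeletionCorrecting` —
  every `VT_a(n)` is a single-deletion-correcting code (Sloane 2002, §2; Levenshtein 1966).
* The decoding algorithm itself, `VT.decode a n`, with its correctness
  `VT.decode_eraseIdx` (it restores every codeword from any of its one-letter deletions), and
  the covering property `VT.decode_mem_code` / `VT.mem_deletionBall_decode`: *every* word of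
  length `n - 1` is decoded to a codeword of `VT_a(n)` of which it is a deletion, so that the
  balls `D₁(u)`, `u ∈ VT_a(n)`, partition `𝔽₂ⁿ⁻¹` — the codes `VT_a(n)` are *perfect*
  (Levenshtein 1992, as reported in Sloane 2002, §2: "the argument … is essentially just a
  refinement of the decoding algorithm"): `VT.existsUnique_mem_code_mem_deletionBall`.
* Sloane's list `VT₀(4) = {0000, 1001, 0110, 1111}` and a decoding run, as `example`s.

## References

* N. J. A. Sloane, *On single-deletion-correcting codes*, Codes and Designs, de Gruyter (2002)
  273–291, arXiv:math/0207197, §1 (Definition 1.1) and §2 (Definition 2.1, the decoding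
  algorithm, the perfectness remark). [Sloane2002]
* V. I. Levenshtein, *Binary codes capable of correcting deletions, insertions and reversals*,
  Soviet Physics Dokl. 10 (1966) 707–710. [Levenshtein1966]

## Design

* Words are `List Bool`; a deletion is `List.eraseIdx`, an insertion `List.insertIdx`
  (positions from `0`, so Sloane's position `p = 1 + L₀ + L₁` is our `p - 1`); the checksum
  weights positions from `1` as in print.
* `VT.code a n` is defined for every `a : ℕ` through `≡ a [MOD n + 1]`; for `0 ≤ a ≤ n` this is
  Sloane's `VT_a(n)`, and in general it is `VT_{a mod (n+1)}(n)`.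
* The decoder returns *some* insertion with the right shift (the first admissible position);
  that this is the transmitted word is exactly the uniqueness statement, so no bookkeeping of
  runs is needed. Not here: the size formula (Sloane 2002, Thm 2.2), optimality questions (§3),
  larger alphabets or several deletions.
-/

namespace Literature.InformationTheory.Coding

open List

section DeletionChannel

variable {α : Type*}

/-- `D₁(u)`: the words obtained from `u` by deleting one letter (Sloane 2002, Definition 1.1,
first-order descendants). [cite: Sloane2002, Def 1.1] -/
def deletionBall (u : List α) : Set (List α) := {v | ∃ i < u.length, v = u.eraseIdx i}

/-- Membership in `D₁(u)` (Sloane 2002, Definition 1.1). [cite: Sloane2002, Def 1.1] -/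
theorem mem_deletionBall_iff {u v : List α} :
    v ∈ deletionBall u ↔ ∃ i < u.length, v = u.eraseIdx i := Iff.rfl

/-- Every one-letter deletion of `u` lies in `D₁(u)` (Sloane 2002, Definition 1.1).
[cite: Sloane2002, Def 1.1] -/
theorem eraseIdx_mem_deletionBall (u : List α) {i : ℕ} (hi : i < u.length) :
    u.eraseIdx i ∈ deletionBall u := ⟨i, hi, rfl⟩

/-- A code `C` is *single-deletion-correcting* if `D₁(u) ∩ D₁(v) = ∅` for all distinct
`u, v ∈ C` (Sloane 2002, Definition 1.1 with `e = 1`). [cite: Sloane2002, Def 1.1] -/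
def IsSingleDeletionCorrecting (C : Set (List α)) : Prop :=
  ∀ ⦃u v : List α⦄, u ∈ C → v ∈ C → u ≠ v → deletionBall u ∩ deletionBall v = ∅

/-- Inserting at a position `p ≤ |z|` is `take p ++ b :: drop p`. [folklore] -/
private theorem insertIdx_eq_take_cons_drop (z : List α) {p : ℕ} (hp : p ≤ z.length) (b : α) :
    z.insertIdx p b = z.take p ++ b :: z.drop p := by
  induction p generalizing z with
  | zero => simp
  | succ p ih =>
    cases z with
    | nil => simp at hp
    | cons c z =>
      rw [insertIdx_succ_cons, ih z (by simpa using hp)]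
      simp

/-- Deleting the inserted letter gives the word back. [folklore] -/
private theorem eraseIdx_insertIdx_self (z : List α) {p : ℕ} (hp : p ≤ z.length) (b : α) :
    (z.insertIdx p b).eraseIdx p = z := by
  have hl : (z.take p).length = p := length_take_of_le hp
  rw [insertIdx_eq_take_cons_drop z hp, eraseIdx_eq_take_drop_succ, take_left' hl,
    show z.take p ++ b :: z.drop p = (z.take p ++ [b]) ++ z.drop p by simp,
    drop_left' (by simp [hl]), take_append_drop]

/-- A stretch of `b`'s followed by one more `b`. [folklore] -/
private theorem replicate_append_cons (k : ℕ) (b : α) (l : List α) :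
    replicate k b ++ b :: l = b :: (replicate k b ++ l) := by
  induction k with
  | zero => rfl
  | succ k ih => simp [replicate_succ, ih]

end DeletionChannel

namespace VT

/-! ### The checksum `∑ i·x_i` -/

/-- The Varshamov–Tenengolts checksum `∑_{i=1}^{n} i·x_i` of a binary word `x = x_1 ⋯ x_n`
(Sloane 2002, Definition 2.1), defined by recursion on the word: prepending a letter `b` shifts
every position by one, which adds the weight. See `checksum_eq_sum` for the printed form.
[cite: Sloane2002, Def 2.1] -/
def checksum : List Bool → ℕ
  | [] => 0
  | b :: x => b.toNat + x.count true + checksum x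

/-- The empty word has checksum `0`. [cite: Sloane2002, Def 2.1] -/
@[simp] theorem checksum_nil : checksum [] = 0 := rfl

/-- Unfolding the checksum of `b :: x`: the new letter has position `1`, the others move up
by one. [cite: Sloane2002, Def 2.1] -/
@[simp] theorem checksum_cons (b : Bool) (x : List Bool) :
    checksum (b :: x) = b.toNat + x.count true + checksum x := rfl

/-- Checksum of a concatenation: the positions of `v` are shifted by `|u|`.
[cite: Sloane2002, Def 2.1] -/
theorem checksum_append (u v : List Bool) :
    checksum (u ++ v) = checksum u + checksum v + u.length * v.count true := by
  induction u with
  | nil => simp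
  | cons c u ih =>
    simp only [cons_append, checksum_cons, count_append, ih, length_cons]
    ring

/-- The weight (number of ones) as a sum of the letters. [folklore] -/
private theorem count_true_eq_sum (x : List Bool) :
    x.count true = ∑ i : Fin x.length, (x.get i).toNat := by
  induction x with
  | nil => simp
  | cons b x ih =>
    rw [count_cons, ih]
    simp only [length_cons, Fin.sum_univ_succ, get_cons_zero, get_cons_succ']
    cases b <;> simp [add_comm]

/-- The recursive checksum is the printed `∑_{i=1}^{n} i·x_i` (positions numbered from `1`).
[cite: Sloane2002, Def 2.1] -/
theorem checksum_eq_sum (x : List Bool) :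
    checksum x = ∑ i : Fin x.length, ((i : ℕ) + 1) * (x.get i).toNat := by
  induction x with
  | nil => simp
  | cons b x ih =>
    rw [checksum_cons, ih, count_true_eq_sum]
    simp only [length_cons, Fin.sum_univ_succ, get_cons_zero, get_cons_succ', Fin.val_zero,
      Fin.val_succ, zero_add, one_mul]
    rw [add_assoc, ← Finset.sum_add_distrib]
    congr 1
    exact Finset.sum_congr rfl fun i _ => by ring

/-! ### The codes `VT_a(n)` -/

/-- The Varshamov–Tenengolts code `VT_a(n)`: the binary words of length `n` with
`∑_{i=1}^{n} i·x_i ≡ a (mod n + 1)` (Sloane 2002, Definition 2.1; introduced by Varshamov and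
Tenengolts 1965 for the `Z`-channel). [cite: Sloane2002, Def 2.1] -/
def code (a n : ℕ) : Set (List Bool) := {x | x.length = n ∧ checksum x ≡ a [MOD n + 1]}

/-- Membership in `VT_a(n)` (Sloane 2002, Definition 2.1). [cite: Sloane2002, Def 2.1] -/
theorem mem_code_iff {a n : ℕ} {x : List Bool} :
    x ∈ code a n ↔ x.length = n ∧ checksum x ≡ a [MOD n + 1] := Iff.rfl

/-- Membership in `VT_a(n)` is decidable (length and a congruence). [folklore] -/
instance (a n : ℕ) (x : List Bool) : Decidable (x ∈ code a n) :=
  inferInstanceAs (Decidable (x.length = n ∧ checksum x ≡ a [MOD n + 1]))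

/-- Sloane 2002, §2: `VT₀(4) = {0000, 1001, 0110, 1111}` — the four listed words are codewords,
and e.g. `0001` is not. -/
example : [false, false, false, false] ∈ code 0 4 ∧ [true, false, false, true] ∈ code 0 4 ∧
    [false, true, true, false] ∈ code 0 4 ∧ [true, true, true, true] ∈ code 0 4 ∧
    [false, false, false, true] ∉ code 0 4 := by decide

/-! ### One insertion and the checksum -/

/-- The amount by which inserting the letter `b` at position `p` (from `0`) into `z` raises the
checksum: `b·(p+1)` for the new letter plus `R₁`, the number of ones to its right, each of which
moves one position up (Sloane 2002, §2, decoding algorithm: the checksum deficiency is `R₁` if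
`s = 0` and `p + R₁` if `s = 1`, positions from `1`). [cite: Sloane2002, §2] -/
def shift (z : List Bool) (p : ℕ) (b : Bool) : ℕ := b.toNat * (p + 1) + (z.drop p).count true

/-- Checksum after one insertion. [cite: Sloane2002, §2] -/
theorem checksum_insertIdx (z : List Bool) {p : ℕ} (hp : p ≤ z.length) (b : Bool) :
    checksum (z.insertIdx p b) = checksum z + shift z p b := by
  rw [insertIdx_eq_take_cons_drop z hp]
  unfold shift
  conv_rhs => rw [← take_append_drop p z]
  rw [checksum_append, checksum_append, checksum_cons, length_take_of_le hp, count_cons,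
    take_append_drop]
  cases b <;> simp <;> ring

/-- Ones to the right are at most the weight. [folklore] -/
private theorem count_drop_le (z : List Bool) (p : ℕ) :
    (z.drop p).count true ≤ z.count true :=
  (drop_sublist p z).count_le true

/-- The weight is at most `p` plus the ones from position `p` on. [folklore] -/
private theorem count_le_add_count_drop (z : List Bool) (p : ℕ) :
    z.count true ≤ p + (z.drop p).count true := by
  have h := congrArg (count true) (take_append_drop p z)
  rw [count_append] at h
  have h3 : (z.take p).count true ≤ p :=
    count_le_length.trans (by rw [length_take]; exact Nat.min_le_left _ _)
  omega

/-- "These numbers are less than `n + 1`": the shift of an insertion into a word of length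
`n - 1` is at most `n` (Sloane 2002, §2). [cite: Sloane2002, §2] -/
theorem shift_le (z : List Bool) {p : ℕ} (hp : p ≤ z.length) (b : Bool) :
    shift z p b ≤ z.length + 1 := by
  have h := (count_le_length (a := true) (l := z.drop p))
  rw [length_drop] at h
  cases b <;> simp [shift] <;> omega

/-- A deleted `0` lowers the checksum by at most the weight `w`, a deleted `1` by more than `w`
(Sloane 2002, §2: "`R₁ (≤ w)`", "`1 + w + L₀ (> w)`"). [cite: Sloane2002, §2] -/
theorem shift_false_le_count (z : List Bool) (p : ℕ) : shift z p false ≤ z.count true := by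
  simpa [shift] using count_drop_le z p

/-- See `shift_false_le_count`. [cite: Sloane2002, §2] -/
theorem count_lt_shift_true (z : List Bool) (p : ℕ) : z.count true < shift z p true := by
  have := count_le_add_count_drop z p
  simp [shift]; omega

/-- Inserting the same letter `b` at either end of a stretch of `b`'s gives the same word.
[folklore] -/
private theorem insertIdx_add_eq_of_forall (z : List Bool) {p k : ℕ} (hpk : p + k ≤ z.length)
    (b : Bool) (h : ∀ c ∈ (z.drop p).take k, c = b) :
    z.insertIdx (p + k) b = z.insertIdx p b := by
  rw [insertIdx_eq_take_cons_drop z hpk, insertIdx_eq_take_cons_drop z (by omega)]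
  have hS : (z.drop p).take k = replicate k b :=
    eq_replicate_iff.2 ⟨length_take_of_le (by rw [length_drop]; omega), h⟩
  have h1 : z.take (p + k) = z.take p ++ replicate k b := by rw [take_add, hS]
  have h2 : z.drop p = replicate k b ++ z.drop (p + k) := by
    calc z.drop p = (z.drop p).take k ++ (z.drop p).drop k := (take_append_drop _ _).symm
      _ = replicate k b ++ z.drop (p + k) := by rw [hS, drop_drop]
  rw [h1, h2, append_assoc, replicate_append_cons]

/-- **No ambiguity** (the heart of Levenshtein's argument, Sloane 2002, §2): two one-letter
insertions into the same word `z` that raise the checksum by the same amount produce the same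
word — equal shifts force the same letter (a `0` shifts by `≤ w`, a `1` by `> w`), and then the
two positions bound a stretch of that letter. [cite: Sloane2002, §2] -/
theorem insertIdx_eq_insertIdx_of_shift_eq (z : List Bool) {p p' : ℕ} (hp : p ≤ z.length)
    (hp' : p' ≤ z.length) {b b' : Bool} (h : shift z p b = shift z p' b') :
    z.insertIdx p b = z.insertIdx p' b' := by
  wlog hle : p ≤ p' generalizing p p' b b'
  · exact (this hp' hp h.symm (le_of_not_ge hle)).symm
  obtain ⟨k, rfl⟩ := Nat.exists_eq_add_of_le hle
  have hseg : (z.drop p).count true =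
      ((z.drop p).take k).count true + (z.drop (p + k)).count true := by
    conv_lhs => rw [← take_append_drop k (z.drop p)]
    rw [count_append, drop_drop]
  have hlenS : ((z.drop p).take k).length = k := length_take_of_le (by rw [length_drop]; omega)
  cases b <;> cases b'
  · -- a `0` both times: no ones strictly between the two positions
    refine (insertIdx_add_eq_of_forall z hp' false fun c hc => ?_).symm
    simp only [shift, Bool.toNat_false, zero_mul, zero_add] at h
    have h0 : ((z.drop p).take k).count true = 0 := by omega
    rw [count_eq_zero] at h0
    cases c
    · rfl
    · exact absurd hc h0
  · -- `0` versus `1`: the shifts lie on opposite sides of the weight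
    have h1 := shift_false_le_count z p
    have h2 := count_lt_shift_true z (p + k)
    omega
  · have h1 := shift_false_le_count z (p + k)
    have h2 := count_lt_shift_true z p
    omega
  · -- a `1` both times: only ones between the two positions
    refine (insertIdx_add_eq_of_forall z hp' true fun c hc => ?_).symm
    simp only [shift, Bool.toNat_true, one_mul] at h
    have hk : ((z.drop p).take k).count true = ((z.drop p).take k).length := by omega
    rw [count_eq_length] at hk
    exact (hk c hc).symm

/-- The same, with the shifts only known modulo `n + 1 = |z| + 2` ("these numbers are less than
`n + 1`"). [cite: Sloane2002, §2] -/
theorem insertIdx_eq_insertIdx_of_checksum_modEq (z : List Bool) {p p' : ℕ} (hp : p ≤ z.length)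
    (hp' : p' ≤ z.length) {b b' : Bool}
    (h : checksum (z.insertIdx p b) ≡ checksum (z.insertIdx p' b') [MOD z.length + 2]) :
    z.insertIdx p b = z.insertIdx p' b' := by
  rw [checksum_insertIdx z hp, checksum_insertIdx z hp'] at h
  have h1 := shift_le z hp b
  have h2 := shift_le z hp' b'
  exact insertIdx_eq_insertIdx_of_shift_eq z hp hp'
    (Nat.ModEq.eq_of_lt_of_lt (Nat.ModEq.add_left_cancel' _ h) (by omega) (by omega))

/-! ### Levenshtein's theorem -/

/-- **The Varshamov–Tenengolts codes correct one deletion** (Levenshtein 1965/66; Sloane 2002,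
§2): two codewords of `VT_a(n)` with a common one-letter deletion are equal.
[cite: Sloane2002, §2] [cite: Levenshtein1966] -/
theorem eq_of_eraseIdx_eq {a n : ℕ} {x y : List Bool} (hx : x ∈ code a n) (hy : y ∈ code a n)
    {i j : ℕ} (hi : i < n) (hj : j < n) (h : x.eraseIdx i = y.eraseIdx j) : x = y := by
  obtain ⟨hxl, hxs⟩ := hx
  obtain ⟨hyl, hys⟩ := hy
  have hi' : i < x.length := by omega
  have hj' : j < y.length := by omega
  have hzl : (x.eraseIdx i).length = n - 1 := by rw [length_eraseIdx_of_lt hi', hxl]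
  have hx' : x = (x.eraseIdx i).insertIdx i x[i] := (insertIdx_eraseIdx_getElem hi').symm
  have hy' : y = (x.eraseIdx i).insertIdx j y[j] := by
    rw [h]; exact (insertIdx_eraseIdx_getElem hj').symm
  rw [hx', hy']
  refine insertIdx_eq_insertIdx_of_checksum_modEq _ (by omega) (by omega) ?_
  rw [← hx', ← hy', hzl, show n - 1 + 2 = n + 1 by omega]
  exact hxs.trans hys.symm

/-- **Levenshtein's theorem** in Sloane's terms: every `VT_a(n)` is a single-deletion-correcting
code, `D₁(u) ∩ D₁(v) = ∅` for distinct codewords (Sloane 2002, §2: "Levenshtein … observed that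
the Varshamov–Tenengolts codes could be used for correcting single deletions").
[cite: Sloane2002, §2] [cite: Levenshtein1966] -/
theorem code_isSingleDeletionCorrecting (a n : ℕ) : IsSingleDeletionCorrecting (code a n) := by
  intro u v hu hv hne
  refine Set.eq_empty_iff_forall_notMem.2 ?_
  rintro w ⟨⟨i, hi, rfl⟩, ⟨j, hj, hw⟩⟩
  exact hne (eq_of_eraseIdx_eq hu hv (by rw [← hu.1]; exact hi) (by rw [← hv.1]; exact hj) hw)

/-! ### The decoding algorithm -/

/-- The deficiency of the checksum of a received word `z` against the class `a (mod n + 1)`,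
as a natural number `< n + 1` (Sloane 2002, §2: "the deficiency in the checksum").
[cite: Sloane2002, §2] -/
def deficiency (a n : ℕ) (z : List Bool) : ℕ :=
  (a % (n + 1) + (n + 1) - checksum z % (n + 1)) % (n + 1)

/-- The deficiency is a residue modulo `n + 1`. [cite: Sloane2002, §2] -/
theorem deficiency_lt (a n : ℕ) (z : List Bool) : deficiency a n z < n + 1 :=
  Nat.mod_lt _ (Nat.succ_pos n)

/-- Adding the deficiency restores the checksum class. [cite: Sloane2002, §2] -/
theorem checksum_add_deficiency_modEq (a n : ℕ) (z : List Bool) :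
    checksum z + deficiency a n z ≡ a [MOD n + 1] := by
  unfold deficiency
  have hr : checksum z % (n + 1) < n + 1 := Nat.mod_lt _ (Nat.succ_pos n)
  calc checksum z + (a % (n + 1) + (n + 1) - checksum z % (n + 1)) % (n + 1)
      ≡ checksum z % (n + 1) + (a % (n + 1) + (n + 1) - checksum z % (n + 1)) [MOD n + 1] :=
        (Nat.mod_modEq _ _).symm.add (Nat.mod_modEq _ _)
    _ = a % (n + 1) + (n + 1) := by omega
    _ ≡ a [MOD n + 1] := Nat.add_modEq_right.trans (Nat.mod_modEq _ _)

/-- A shift that restores the checksum class *is* the deficiency (both are `< n + 1`).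
[cite: Sloane2002, §2] -/
theorem shift_eq_deficiency {a n : ℕ} {z : List Bool} (hz : z.length + 1 = n) {p : ℕ}
    (hp : p ≤ z.length) {b : Bool} (h : checksum (z.insertIdx p b) ≡ a [MOD n + 1]) :
    shift z p b = deficiency a n z := by
  rw [checksum_insertIdx z hp] at h
  have h' : shift z p b ≡ deficiency a n z [MOD n + 1] :=
    Nat.ModEq.add_left_cancel' _ (h.trans (checksum_add_deficiency_modEq a n z).symm)
  exact Nat.ModEq.eq_of_lt_of_lt h' (by have := shift_le z hp b; omega) (deficiency_lt a n z)

/-- **Levenshtein's decoder** for `VT_a(n)` (Sloane 2002, §2, "Decoding algorithm"): compute the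
weight `w` of the received word `z` and the deficiency `Δ` of its checksum; if `Δ ≤ w` a `0` was
deleted and is restored with `Δ` ones to its right, otherwise a `1` was deleted and is restored
with `Δ - w - 1` zeros to its left. (Any admissible position gives the same word, by
`insertIdx_eq_insertIdx_of_shift_eq`; we take the first.) [cite: Sloane2002, §2] -/
def decode (a n : ℕ) (z : List Bool) : List Bool :=
  if deficiency a n z ≤ z.count true then
    z.insertIdx (((range (z.length + 1)).find? fun p =>
      (z.drop p).count true == deficiency a n z).getD 0) false
  else
    z.insertIdx (((range (z.length + 1)).find? fun p =>
      (z.take p).count false == deficiency a n z - z.count true - 1).getD 0) true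

/-- A run of the decoder on Sloane's codeword `0110 ∈ VT₀(4)`: with its second letter deleted it
is received as `010` (checksum `2`, deficiency `3 > w = 1`), so a `1` is restored to the right of
the leftmost `3 - 1 - 1 = 1` zero. -/
example : decode 0 4 [false, true, false] = [false, true, true, false] := by decide

/-- For binary words, zeros plus ones is the length. [folklore] -/
private theorem count_false_add_count_true (l : List Bool) :
    l.count false + l.count true = l.length := by
  induction l with
  | nil => simp
  | cons b l ih => cases b <;> simp <;> omega

/-- Ones up to position `p` plus ones from position `p` on is the weight. [folklore] -/
private theorem count_take_add_count_drop (z : List Bool) (p : ℕ) :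
    (z.take p).count true + (z.drop p).count true = z.count true := by
  rw [← count_append, take_append_drop]

/-- A step function that never rises by more than one takes every value between its start and
its end (discrete intermediate value property). [folklore] -/
private theorem exists_eq_of_le_succ {g : ℕ → ℕ} {m t : ℕ} (h0 : g 0 ≤ t) (hm : t ≤ g m)
    (hstep : ∀ p < m, g (p + 1) ≤ g p + 1) : ∃ p ≤ m, g p = t := by
  induction m with
  | zero => exact ⟨0, le_rfl, le_antisymm h0 hm⟩
  | succ m ih =>
    by_cases ht : t ≤ g m
    · obtain ⟨p, hp, hgp⟩ := ih ht fun p hp => hstep p (by omega)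
      exact ⟨p, by omega, hgp⟩
    · have := hstep m (by omega)
      exact ⟨m + 1, le_rfl, by omega⟩

/-- The same for a step function that never falls by more than one. [folklore] -/
private theorem exists_eq_of_le_succ' {g : ℕ → ℕ} {m t : ℕ} (h0 : t ≤ g 0) (hm : g m ≤ t)
    (hstep : ∀ p < m, g p ≤ g (p + 1) + 1) : ∃ p ≤ m, g p = t := by
  induction m with
  | zero => exact ⟨0, le_rfl, le_antisymm hm h0⟩
  | succ m ih =>
    by_cases ht : g m ≤ t
    · obtain ⟨p, hp, hgp⟩ := ih ht fun p hp => hstep p (by omega)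
      exact ⟨p, by omega, hgp⟩
    · have := hstep m (by omega)
      exact ⟨m + 1, le_rfl, by omega⟩

/-- Dropping one more letter loses at most one `1`. [folklore] -/
private theorem count_drop_le_count_drop_succ (z : List Bool) (p : ℕ) :
    (z.drop p).count true ≤ (z.drop (p + 1)).count true + 1 := by
  have h := congrArg (count true) (take_append_drop 1 (z.drop p))
  rw [drop_drop, count_append] at h
  have h1 : ((z.drop p).take 1).count true ≤ 1 := count_le_length.trans (length_take_le _ _)
  omega

/-- Taking one more letter gains at most one `0`. [folklore] -/
private theorem count_take_succ_le (z : List Bool) (p : ℕ) :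
    (z.take (p + 1)).count false ≤ (z.take p).count false + 1 := by
  rw [take_add, count_append]
  have h1 : ((z.drop p).take 1).count false ≤ 1 := count_le_length.trans (length_take_le _ _)
  omega

/-- The decoder always returns a one-letter insertion with shift equal to the deficiency: the
wanted position exists because `R₁` runs through every value `≤ w` and `L₀` through every value
`≤ n - 1 - w` (Sloane 2002, §2). [cite: Sloane2002, §2] -/
theorem decode_eq_insertIdx {a n : ℕ} {z : List Bool} (hz : z.length + 1 = n) :
    ∃ p ≤ z.length, ∃ b : Bool,
      decode a n z = z.insertIdx p b ∧ shift z p b = deficiency a n z := by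
  have hΔ := deficiency_lt a n z
  unfold decode
  split_ifs with hle
  · -- a `0`: find `p` with exactly `Δ` ones from position `p` on
    obtain ⟨q, hq, hgq⟩ : ∃ q ≤ z.length, (z.drop q).count true = deficiency a n z :=
      exists_eq_of_le_succ' (g := fun q => (z.drop q).count true) (by simpa using hle)
        (by simp) fun q _ => count_drop_le_count_drop_succ z q
    have hsome : ((range (z.length + 1)).find? fun p =>
        (z.drop p).count true == deficiency a n z).isSome :=
      find?_isSome.2 ⟨q, mem_range.2 (by omega), by simpa using hgq⟩
    obtain ⟨p, hp⟩ := Option.isSome_iff_exists.1 hsome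
    have hpz : p ≤ z.length := by
      have := mem_of_find?_eq_some hp; rw [mem_range] at this; omega
    have hpP : (z.drop p).count true = deficiency a n z := by simpa using find?_some hp
    refine ⟨p, hpz, false, by rw [hp, Option.getD_some], ?_⟩
    simpa [shift] using hpP
  · -- a `1`: find `p` with exactly `Δ - w - 1` zeros before position `p`
    rw [not_le] at hle
    have hw := count_false_add_count_true z
    obtain ⟨q, hq, hgq⟩ : ∃ q ≤ z.length,
        (z.take q).count false = deficiency a n z - z.count true - 1 :=
      exists_eq_of_le_succ (g := fun q => (z.take q).count false) (by simp)
        (by simp only [take_length]; omega) fun q _ => count_take_succ_le z q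
    have hsome : ((range (z.length + 1)).find? fun p =>
        (z.take p).count false == deficiency a n z - z.count true - 1).isSome :=
      find?_isSome.2 ⟨q, mem_range.2 (by omega), by simpa using hgq⟩
    obtain ⟨p, hp⟩ := Option.isSome_iff_exists.1 hsome
    have hpz : p ≤ z.length := by
      have := mem_of_find?_eq_some hp; rw [mem_range] at this; omega
    have hpP : (z.take p).count false = deficiency a n z - z.count true - 1 := by
      simpa using find?_some hp
    refine ⟨p, hpz, true, by rw [hp, Option.getD_some], ?_⟩
    have h1 := count_take_add_count_drop z p
    have h2 := count_false_add_count_true (z.take p)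
    rw [length_take_of_le hpz] at h2
    simp only [shift, Bool.toNat_true, one_mul]
    omega

/-- The decoder's output is a codeword of `VT_a(n)` … [cite: Sloane2002, §2] -/
theorem decode_mem_code {a n : ℕ} {z : List Bool} (hz : z.length + 1 = n) :
    decode a n z ∈ code a n := by
  obtain ⟨p, hp, b, hd, hs⟩ := decode_eq_insertIdx (a := a) hz
  refine ⟨by rw [hd, length_insertIdx, if_pos hp, hz], ?_⟩
  rw [hd, checksum_insertIdx z hp, hs]
  exact checksum_add_deficiency_modEq a n z

/-- … of which the received word is a one-letter deletion. [cite: Sloane2002, §2] -/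
theorem mem_deletionBall_decode {a n : ℕ} {z : List Bool} (hz : z.length + 1 = n) :
    z ∈ deletionBall (decode a n z) := by
  obtain ⟨p, hp, b, hd, -⟩ := decode_eq_insertIdx (a := a) hz
  refine ⟨p, by rw [hd, length_insertIdx, if_pos hp]; omega, ?_⟩
  rw [hd, eraseIdx_insertIdx_self z hp]

/-- **Correctness of Levenshtein's decoder** (Sloane 2002, §2): deleting any one letter of a
codeword `x ∈ VT_a(n)` and decoding gives back `x`. [cite: Sloane2002, §2] [cite: Levenshtein1966] -/
theorem decode_eraseIdx {a n : ℕ} {x : List Bool} (hx : x ∈ code a n) {i : ℕ} (hi : i < n) :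
    decode a n (x.eraseIdx i) = x := by
  have hi' : i < x.length := by rw [hx.1]; exact hi
  have hz : (x.eraseIdx i).length + 1 = n := by rw [length_eraseIdx_of_lt hi', hx.1]; omega
  obtain ⟨p, hp, b, hd, hs⟩ := decode_eq_insertIdx (a := a) hz
  have hx' : x = (x.eraseIdx i).insertIdx i x[i] := (insertIdx_eraseIdx_getElem hi').symm
  have hiz : i ≤ (x.eraseIdx i).length := by omega
  have hsi : shift (x.eraseIdx i) i x[i] = deficiency a n (x.eraseIdx i) :=
    shift_eq_deficiency hz hiz (by rw [← hx']; exact hx.2)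
  have key : (x.eraseIdx i).insertIdx p b = (x.eraseIdx i).insertIdx i x[i] :=
    insertIdx_eq_insertIdx_of_shift_eq _ hp hiz (hs.trans hsi.symm)
  rw [hd, key]
  exact insertIdx_eraseIdx_getElem hi'

/-- **The codes `VT_a(n)` are perfect** (Levenshtein 1992, reported in Sloane 2002, §2: "all the
codes `VT₀(n), VT₁(n), VT₂(n), …` are perfect single-deletion-correcting codes"): every binary
word of length `n - 1` lies in the deletion ball of exactly one codeword of `VT_a(n)`, i.e. the
balls `D₁(u)`, `u ∈ VT_a(n)`, partition `𝔽₂ⁿ⁻¹`. Existence is the decoder, uniqueness is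
Levenshtein's theorem. [cite: Sloane2002, §2] -/
theorem existsUnique_mem_code_mem_deletionBall (a n : ℕ) {z : List Bool}
    (hz : z.length + 1 = n) : ∃! u, u ∈ code a n ∧ z ∈ deletionBall u := by
  refine ⟨decode a n z, ⟨decode_mem_code hz, mem_deletionBall_decode hz⟩, ?_⟩
  rintro u ⟨hu, i, hi, rfl⟩
  exact (decode_eraseIdx hu (by rw [← hu.1]; exact hi)).symm

end VT

end Literature.InformationTheory.Coding
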